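import Summits.ValiantsHypothesis.ValiantsHypothesis.Theorems.NewtonUnitEquationsTwoProductsRankOneSchemaLawSlice
import HarnessLib

/-!
# Route NewtonUnitEquations — crux `TwoProducts` (stmt-ValiantsHypothesis-5906), line `relation_ladder`, rung R9 (the RANK-ONE
# SCHEMA law: ONE datum `(ρ⁺, ρ⁻)` of ANY shape) by the TRANSPORTATION LIFT — part 4/8 — the exceptional point of a slice, the support criterion, `xOf`, `Fsl_congr` (T4 end)

THE RANK-ONE SCHEMA LAW (R9): if ALL additive coincidences of the letter family of `(u, v)` are multiples of ONE datum `(ρ⁺, ρ⁻)` —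
ANY datum `ρ⁺, ρ⁻ : Expo →₀ ℕ`, no side condition — then GLOBALLY `#visible ≤ 2^{c m}(#T + 2)^c` (`c = 1416`).  This is the rank-one SCHEMA
quantified over the datum asked for by the Negative lane (val-neg-1 g4, evidence #48 on stmt-5906, item (a)); it SUBSUMES the rungs R3♯
(`permTypeLaw_proof`), R6, R6b, R6c, R7a, R7b, R7c, R8 (each of their hypotheses exhibits a datum).  Engine = the TRANSPORTATION LIFT of
val-idea-8 g3's memo `Cruxes/TwoProducts/Lines/relation_ladder_R7_engine.md` §1 / `…R8_engine.md` §5 made uniform: for the disjoint balanced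
relation `Σ_{i ∈ P} p_i • α_i = Σ_{j ∈ N} q_j • β_j` the atoms are `Z_{ij}`, `(i, j) ∈ P × N` (upstairs index type `σ ⊕ σ × σ`: free letters on
the left, atoms on the right), `Y_{α_i} ↦ ∏_j Z_{ij}^{q_j}`, `Y_{β_j} ↦ ∏_i Z_{ij}^{p_i}`; the planar push-forward is the PRODUCT PLAN
`E'(Z_{ij})_c = (α_i)_c (β_j)_c T'_{1-c}` over the `D = T'_0 T'_1`-dilated plane (`T_c = Σ_i p_i (α_i)_c`, `T' = max(T, 1)`), the upstairs
weights are the PRODUCT PLAN `θ_{ij} = r_i r_j / R` of the letter weights (pointwise positive, NOT a pull-back; balanced because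
`Σ p_i r_i = Σ q_j r_j`); the fibre over an atom monomial is parametrised by `κ = #α_{a₀}` with a CONSISTENCY guard over all `|P|·|N|` atom
equations; SLICING by the atom exponents (≤ `2^{3m}` slices through the simplex `R8.card_W_le`); the coefficient theorem
`Pfac · C(R + B_κ − 1, B_κ) · κ_κ` and the shift rank `2m(ΣA + 1)² + 1` are shape-independent (the free letters enter only through the binomial);
`ShiftRank.pencilCount` BY NAME.  Reductions: common part of the datum (`DatumExcess.rankOne_reduce`), large / absent coefficients
(`R7a.permType_of_rankOne_largeCoeff/absent`), wide sides (`permType_of_rankOne_wideSide`), and a non-permutation coincidence balances the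
datum and makes both sides non-empty (`sides_of_shift`, over val-neg-1 g4's `OneSidedMembership.weight_*` / `DatumExcess.*`).

AUTHORSHIP / LANE NOTE (val-lit-p3 g16, prover seat, KEEP lineage, helper mode `--supports stmt-ValiantsHypothesis-5906 --as helper`;
CLAIM #1 on the val-lit bus 14:45Z 2026-08-28, ★ 15:03Z; no val-idea-8 seat alive at the time — the typed target is staged for the line
owner as `HOME/lmr/staged/p3g16-R9/sketch_R9.lean`, and the closing theorem is stated by its LITERAL BODY so that a later skeleton can wire
`stub := R9.rankOneSchemaLaw_proof` by name).  Mathematics and Lean text of this module: this seat, generalising its predecessor's R8 port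
(`…RankOneOneSidedLaw*`, val-lit-p3 g15) decl by decl.  Reused BY NAME: `R6b.HSD` (+ closure lemmas), `R7b.dilE`/`piT_dilE`/`piE_dilE`,
`R7a.choose_bridge`, `R7a.permType_of_rankOne_largeCoeff/absent`, `toolBound_mono`, `tab`, `sgn`, `R6b.sum_sgn`, `rW`/`R6b.rW_pos`, `lwt_piT`,
`PlanarCell.eq_of_nsmul_eq`/`wt_sum`, `FormalLogLinearisation.wt_nsmul`, `R8.W`/`R8.card_W_le`, `ShiftRank.pencilCount`,
`BinExpSum.pencilCount_arith`, val-neg-1 g4's `DatumExcess.*`, `RankOneCoverage.eq_of_tsub_eq_zero`, `OneSidedMembership.*`.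
Namespace `…PermutationType.R9`.  Nothing here closes the line's residual (`ResidualLawV20`), the crux `TwoProducts` (5906) or `VP ≠ VNP`;
no summit statement is proved.

Honest scope: coincidence modules of RANK ≥ 2 (val-neg-1 g4's p635223 `RankTwoEscapes`) are NOT covered; after R9 the residual of the line is
«no lattice-small permutation-type contraction (R5), no cheap class cover (R1_r), coincidence rank ≥ 2».  Nothing here moves VP ≠ VNP;
`TwoProducts` (5906) / `PlanarCellBound` stay OPEN. [folklore]

Cut table (scratch `HOME/lmr/staged/p3g16-R9/R9-Scratch.lean`, 2 249 lines, rc 0 / 0 warnings / 0 sorries, axioms standard): part 1 `…Lift` =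
T2 (`GIdx`, `P`/`N`/`rel`/`rest`, `frM` and its coordinates, `Idle`, the table sums `sum_frM_inl/inr`); part 2 `…Fibres` = T3 (`xhat`, `Lrel`,
`Lof`, `Adm`, `sA`, `KR`, `eq_Lof_of_piT`, `piT_Lof`, degrees, `Bk`, `Pfac`, `kap`, `multinomial_Lof_eq`, `coeff_phiT_frM`); part 3 `…Slice` =
T4 slice functions, THE COEFFICIENT THEOREM `coeff_free_logTrunc`, T5 finite shift rank `Fsl_shift`; part 4 `…SliceExc` = the exceptional point,
`mem_support_free_logTrunc_iff`, `Fsl_zero_zero`, `xOf`, `Fsl_congr`; part 5 `…Planar` = T7 `RelDataG`, `D`, `cell`, `enumP`, `piE_enumP_frM`,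
`phi_GT`, `injOn_of_rankOne`, `lifted_of_visible`; part 6 `…Weights` = product-plan weights `θW`, `lwt_θW_frM`, `lwt_splitG`, T8
`sliceMin_of_visible`; part 7 `…Count` = `sliceCount`, `RelDataG.count`, `permType_of_rankOne_wideSide`, `sides_of_shift`, `sum_enum_smul_eq`,
`mapDomain_enum_table`; part 8 `…Law` = arithmetic (`c = 1416`), `rankOneSchemaLaw_proof`.
-/

noncomputable section

-- Sub = Summit single-conjunct layout: the duplicated namespace component is mandated by the tree.
set_option linter.dupNamespace false
set_option linter.unusedSimpArgs false
set_option linter.unusedSectionVars false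
set_option linter.unusedVariables false

namespace Summit.ValiantsHypothesis.ValiantsHypothesis.Theorems.NewtonUnitEquations.TwoProducts.PermutationType
namespace R9
open scoped BigOperators
open MvPolynomial

variable {σ : Type*} [Fintype σ] [DecidableEq σ]

variable (Itr : GIdx σ)

section Slice
variable {m : ℕ}

/-! ### The exceptional point of a slice (`R = 0`, i.e. `x` supported on the atoms) -/

/-- At an exceptional exponent every free coordinate vanishes. [folklore] -/
theorem exc_apply (x : σ ⊕ σ × σ →₀ ℕ) (hx : Idle Itr x) (h0 : deg (xhat Itr x) = 0) (k : σ) : x (Sum.inl k) = 0 := by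
  have hz : xhat Itr x = 0 := (deg_eq_zero_iff _).mp h0
  by_cases hk : Itr.pf k = 0 ∧ Itr.qf k = 0
  · have := DFunLike.congr_fun hz k
    rwa [xhat_rest Itr x ((mem_rest Itr k).2 hk)] at this
  · exact hx.1 k hk

/-- At an exceptional exponent the reduced exponent is zero. [folklore] -/
theorem xhat_exc_apply (x : σ ⊕ σ × σ →₀ ℕ) (h0 : deg (xhat Itr x) = 0) (k : σ) : xhat Itr x k = 0 := by
  rw [(deg_eq_zero_iff _).mp h0]; rfl

/-- At an exceptional exponent the free product is `1`. [folklore] -/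
theorem restProd_exc (t : σ → ℂ) (x : σ ⊕ σ × σ →₀ ℕ) (h0 : deg (xhat Itr x) = 0) : restProd Itr t ⇑(xhat Itr x) = 1 := by
  unfold restProd
  exact Finset.prod_eq_one fun k _ => by rw [xhat_exc_apply Itr x h0 k, pow_zero]

/-- At an exceptional exponent the multinomial of the fibre element is `κ_κ`. [folklore] -/
theorem multinomial_exc (x : σ ⊕ σ × σ →₀ ℕ) (hx : Idle Itr x) (h0 : deg (xhat Itr x) = 0) (κ : ℕ) :
    ((Lof Itr x κ).multinomial : ℂ) = kap Itr (fun ij => x (Sum.inr ij)) κ := by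
  have hdeg := deg_Lof_eq Itr x κ
  rw [h0, zero_add] at hdeg
  have s := Nat.multinomial_spec (Finset.univ : Finset σ) (Lof Itr x κ)
  rw [← multinomial_univ, ← deg_eq_sum, prod_split Itr, hdeg] at s
  have hr : ∏ k ∈ rest Itr, ((Lof Itr x κ) k).factorial = 1 := by
    refine Finset.prod_eq_one fun k hk => ?_
    rw [Lof_rest Itr x κ hk, exc_apply Itr x hx h0 k, Nat.factorial_zero]
  have hb : ∏ k ∈ rel Itr, ((Lof Itr x κ) k).factorial = ∏ k ∈ rel Itr, (Lrel Itr (fun ij => x (Sum.inr ij)) κ k).factorial :=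
    Finset.prod_congr rfl fun k hk => by rw [Lof_rel Itr x κ hk]
  rw [hr, hb, one_mul] at s
  have hKd : (((∏ k ∈ rel Itr, (Lrel Itr (fun ij => x (Sum.inr ij)) κ k).factorial : ℕ)) : ℂ) ≠ 0 :=
    Nat.cast_ne_zero.mpr (Finset.prod_ne_zero_iff.mpr fun k _ => Nat.factorial_ne_zero _)
  unfold kap
  rw [eq_div_iff hKd]
  have e : ((((∏ k ∈ rel Itr, (Lrel Itr (fun ij => x (Sum.inr ij)) κ k).factorial) *
      (Lof Itr x κ).multinomial : ℕ)) : ℂ) = (((Bk Itr (fun ij => x (Sum.inr ij)) κ).factorial : ℕ) : ℂ) := by exact_mod_cast s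
  push_cast at e ⊢
  linear_combination e

/-- The signed atom sum of the constants of an admissible `κ`. [folklore] -/
theorem sum_mainConst (c d : Fin m → σ → ℂ) (b : σ × σ → ℕ) (κ : ℕ) (hκ : Adm Itr b κ) :
    ∑ j, mainConst Itr c d b j κ = (-1 : ℂ) ^ (sA Itr b + Bk Itr b κ) * kap Itr b κ *
      (∑ j : Fin m, relProd Itr (c j) b κ - ∑ j : Fin m, relProd Itr (d j) b κ) := by
  rw [Fintype.sum_sum_type]
  simp only [mainConst, gd_pos Itr hκ, tab, sgn, Sum.elim_inl, Sum.elim_inr]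
  rw [mul_sub, Finset.mul_sum, Finset.mul_sum, sub_eq_add_neg, ← Finset.sum_neg_distrib]
  congr 1
  · exact Finset.sum_congr rfl fun j _ => by ring
  · exact Finset.sum_congr rfl fun j _ => by ring

/-- The slice function at the exceptional point: only the correction survives. [folklore] -/
theorem Fsl_exc (c d : Fin m → σ → ℂ) (b : σ × σ → ℕ) (hb : 1 ≤ sA Itr b) (ν : σ → ℕ) (hν : ∀ k, ν k = 0) :
    Fsl Itr c d b ν = ∑ j : Fin m ⊕ Fin m, ∑ κ : Fin (sA Itr b + 1), mainConst Itr c d b j κ / ((Bk Itr b κ : ℕ) : ℂ) := by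
  have hmain : ∑ j : Fin m ⊕ Fin m, ∑ κ : Fin (sA Itr b + 1), mainTerm Itr c d b j κ ν = 0 := by
    refine Finset.sum_eq_zero fun j _ => Finset.sum_eq_zero fun κ _ => ?_
    unfold mainTerm
    by_cases hκ : Adm Itr b κ
    · have hlam : lam Itr ν = 0 := by unfold lam; simp [hν]
      have hB := Bk_pos Itr hκ hb
      rw [hlam, Nat.choose_eq_zero_of_lt (by omega)]
      simp
    · rw [mainConst_eq_zero Itr c d hκ j, zero_mul]
  unfold Fsl
  rw [hmain, mul_zero, zero_add]
  unfold corr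
  rw [if_pos hν]

/-- A nonzero idle-free exponent with zero reduced part has positive atom mass. [folklore] -/
theorem sA_pos_of_exc (x : σ ⊕ σ × σ →₀ ℕ) (hx : Idle Itr x) (hne : x ≠ 0) (h0 : deg (xhat Itr x) = 0) :
    1 ≤ sA Itr (fun ij => x (Sum.inr ij)) := by
  by_contra hlt
  apply hne
  have hs : sA Itr (fun ij => x (Sum.inr ij)) = 0 := by omega
  have hall : ∀ i ∈ P Itr, ∀ j ∈ N Itr, x (Sum.inr (i, j)) = 0 := fun i hi j hj => by
    unfold sA at hs
    have h1 := (Finset.sum_eq_zero_iff.mp hs) i hi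
    exact (Finset.sum_eq_zero_iff.mp h1) j hj
  ext t
  rcases t with k | ⟨i, j⟩
  · exact exc_apply Itr x hx h0 k
  · by_cases hij : Itr.pf i ≠ 0 ∧ Itr.qf j ≠ 0
    · exact hall i ((mem_P Itr i).2 hij.1) j ((mem_N Itr j).2 hij.2)
    · exact hx.2 i j hij

/-- **THE COEFFICIENT THEOREM at an exceptional exponent** (`x̂ = 0`, `x ≠ 0` supported on the atoms). [folklore] -/
theorem coeff_free_logTrunc_exc (c d : Fin m → σ → ℂ) (R : ℕ) (x : σ ⊕ σ × σ →₀ ℕ) (hx : Idle Itr x)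
    (h0 : deg (xhat Itr x) = 0) (hbc : 1 ≤ sA Itr (fun ij => x (Sum.inr ij))) (hR : deg x ≤ R) :
    coeff x (phiT (frM Itr) (logTrunc c d R)) =
      (-1 : ℂ) ^ (sA Itr (fun ij => x (Sum.inr ij)) + 1) * Fsl Itr c d (fun ij => x (Sum.inr ij)) ⇑(xhat Itr x) := by
  classical
  rw [coeff_phiT_frM Itr _ x hx]
  have hdx : deg x = sA Itr (fun ij => x (Sum.inr ij)) := by rw [deg_eq_deg_xhat_add Itr x hx, h0, zero_add]
  have hz : ∀ k, (xhat Itr x) k = 0 := xhat_exc_apply Itr x h0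
  rw [Fsl_exc Itr c d _ hbc _ hz, Finset.sum_comm, Finset.mul_sum]
  rw [Fin.sum_univ_eq_sum_range (fun κ => (-1 : ℂ) ^ (sA Itr (fun ij => x (Sum.inr ij)) + 1) *
    ∑ j : Fin m ⊕ Fin m, mainConst Itr c d (fun ij => x (Sum.inr ij)) j κ / ((Bk Itr (fun ij => x (Sum.inr ij)) κ : ℕ) : ℂ))
    (sA Itr (fun ij => x (Sum.inr ij)) + 1)]
  unfold KR
  rw [Finset.sum_filter]
  refine Finset.sum_congr rfl fun κ _ => ?_
  by_cases hκ : Adm Itr (fun ij => x (Sum.inr ij)) κ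
  · rw [if_pos hκ]
    have hdeg := deg_Lof_eq Itr x κ
    rw [h0, zero_add] at hdeg
    have hB1 := Bk_pos Itr hκ hbc
    have hBle := Bk_le Itr hκ
    have hdeg1 : 1 ≤ deg (Lof Itr x κ) := by omega
    have hdegR : deg (Lof Itr x κ) ≤ R := by omega
    rw [coeff_logTrunc c d R _ hdeg1 hdegR, multinomial_exc Itr x hx h0 κ, hdeg]
    have hsign : (-1 : ℂ) ^ (Bk Itr (fun ij => x (Sum.inr ij)) κ + 1) =
        (-1) ^ (sA Itr (fun ij => x (Sum.inr ij)) + 1) *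
          (-1) ^ (sA Itr (fun ij => x (Sum.inr ij)) + Bk Itr (fun ij => x (Sum.inr ij)) κ) := by
      have e : sA Itr (fun ij => x (Sum.inr ij)) + 1 + (sA Itr (fun ij => x (Sum.inr ij)) + Bk Itr (fun ij => x (Sum.inr ij)) κ) =
          (Bk Itr (fun ij => x (Sum.inr ij)) κ + 1) + 2 * sA Itr (fun ij => x (Sum.inr ij)) := by omega
      rw [← pow_add, e, pow_add (-1 : ℂ) (Bk Itr (fun ij => x (Sum.inr ij)) κ + 1), pow_mul]
      norm_num
    rw [hsign, ← Finset.sum_div, sum_mainConst Itr c d _ κ hκ]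
    simp only [mom_Lof Itr _ x κ, restProd_exc Itr _ x h0, mul_one]
    ring
  · rw [if_neg hκ]
    rw [Finset.sum_eq_zero (fun j _ => by rw [mainConst_eq_zero Itr c d hκ j, zero_div]), mul_zero]

/-- **The support criterion**: a nonzero idle-free `x` with `deg x ≤ R` lies in the support of the lift of `Λ_R` iff
`F_{x|atoms}(x̂) ≠ 0`. [folklore] -/
theorem mem_support_free_logTrunc_iff (c d : Fin m → σ → ℂ) (R : ℕ) (x : σ ⊕ σ × σ →₀ ℕ) (hx : Idle Itr x)
    (hne : x ≠ 0) (hR : deg x ≤ R) :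
    x ∈ (phiT (frM Itr) (logTrunc c d R)).support ↔ Fsl Itr c d (fun ij => x (Sum.inr ij)) ⇑(xhat Itr x) ≠ 0 := by
  rw [mem_support_iff]
  by_cases h1 : 1 ≤ deg (xhat Itr x)
  · rw [coeff_free_logTrunc Itr c d R x hx h1 hR]
    have hc : (-1 : ℂ) ^ (deg x + 1) * Pfac Itr x ≠ 0 :=
      mul_ne_zero (pow_ne_zero _ (neg_ne_zero.mpr one_ne_zero)) (Pfac_ne_zero Itr x)
    constructor
    · intro h hF; exact h (by rw [hF, mul_zero])
    · intro h; exact mul_ne_zero hc h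
  · have h0 : deg (xhat Itr x) = 0 := by omega
    have hbc := sA_pos_of_exc Itr x hx hne h0
    rw [coeff_free_logTrunc_exc Itr c d R x hx h0 hbc hR]
    have hc : (-1 : ℂ) ^ (sA Itr (fun ij => x (Sum.inr ij)) + 1) ≠ 0 := pow_ne_zero _ (neg_ne_zero.mpr one_ne_zero)
    constructor
    · intro h hF; exact h (by rw [hF, mul_zero])
    · intro h; exact mul_ne_zero hc h

/-- Non-vanishing of a slice function forces `ν = 0` on the relation letters. [folklore] -/
theorem shape_of_Fsl_ne_zero (c d : Fin m → σ → ℂ) (b : σ × σ → ℕ) (ν : σ → ℕ) (h : Fsl Itr c d b ν ≠ 0) :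
    ∀ k ∈ rel Itr, ν k = 0 := by
  by_contra hcon
  apply h
  unfold Fsl ind corr
  rw [if_neg hcon, zero_mul, zero_add, if_neg]
  intro hall
  exact hcon fun k _ => hall k

/-- On a slice of zero atom mass the relation part of `κ = 0` vanishes. [folklore] -/
theorem Lrel_zero_of_sA_zero (b : σ × σ → ℕ) (hb : sA Itr b = 0) (k : σ) : Lrel Itr b 0 k = 0 := by
  have hall : ∀ i ∈ P Itr, ∀ j ∈ N Itr, b (i, j) = 0 := fun i hi j hj => by
    unfold sA at hb
    exact (Finset.sum_eq_zero_iff.mp ((Finset.sum_eq_zero_iff.mp hb) i hi)) j hj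
  by_cases hka : k = Itr.a₀
  · rw [hka, Lrel_a₀]
  by_cases hkN : k ∈ N Itr
  · rw [Lrel_N Itr b 0 hkN, hall Itr.a₀ (a₀_mem_P Itr) k hkN]; simp
  by_cases hkP : k ∈ P Itr
  · rw [Lrel_P Itr b 0 hkP hka, Lrel_N Itr b 0 (b₀_mem_N Itr), hall k hkP Itr.b₀ (b₀_mem_N Itr),
      hall Itr.a₀ (a₀_mem_P Itr) Itr.b₀ (b₀_mem_N Itr)]; simp
  · have hkr : k ∈ rest Itr := by
      rw [mem_rest]; rw [mem_P] at hkP; rw [mem_N] at hkN; push Not at hkP hkN; exact ⟨hkP, hkN⟩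
    exact Lrel_rest Itr b 0 hkr

/-- The slice function of a slice of zero atom mass vanishes at the origin (equal numbers of `±` atoms). [folklore] -/
theorem Fsl_zero_zero (c d : Fin m → σ → ℂ) (b : σ × σ → ℕ) (hb : sA Itr b = 0) (ν : σ → ℕ) (hν : ∀ k, ν k = 0) :
    Fsl Itr c d b ν = 0 := by
  have hall : ∀ i ∈ P Itr, ∀ j ∈ N Itr, b (i, j) = 0 := fun i hi j hj => by
    unfold sA at hb
    exact (Finset.sum_eq_zero_iff.mp ((Finset.sum_eq_zero_iff.mp hb) i hi)) j hj
  have hL := Lrel_zero_of_sA_zero Itr b hb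
  have hadm : Adm Itr b 0 := fun i hi j hj => by rw [hL i, hL j, hall i hi j hj]; simp
  have hB : Bk Itr b 0 = 0 := Finset.sum_eq_zero fun k _ => hL k
  have hpp : ∀ t : σ → ℂ, relProd Itr t b 0 = 1 := fun t => Finset.prod_eq_one fun k _ => by rw [hL k, pow_zero]
  have hkap : kap Itr b 0 = 1 := by
    unfold kap; rw [hB]
    have : ∏ k ∈ rel Itr, (Lrel Itr b 0 k).factorial = 1 := Finset.prod_eq_one fun k _ => by rw [hL k]; rfl
    rw [this]; simp
  have hgd : gd Itr b 0 = 1 := gd_pos Itr hadm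
  have hmain : ∀ j : Fin m ⊕ Fin m, ∑ κ : Fin (sA Itr b + 1), mainTerm Itr c d b j κ ν = sgn m j := by
    intro j
    rw [hb, Fin.sum_univ_one]
    show mainTerm Itr c d b j 0 ν = sgn m j
    unfold mainTerm mainConst restProd
    rw [hgd, hkap, hB, hpp, hb]
    simp [hν]
  have hcorr : corr Itr c d b ν = 0 := by
    unfold corr
    rw [if_pos hν, hb]
    have : ∀ j : Fin m ⊕ Fin m, ∑ κ : Fin (0 + 1), mainConst Itr c d b j κ / ((Bk Itr b κ : ℕ) : ℂ) = 0 := by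
      intro j
      rw [Fin.sum_univ_one]
      show mainConst Itr c d b j 0 / ((Bk Itr b 0 : ℕ) : ℂ) = 0
      rw [hB]; simp
    simp only [this, Finset.sum_const_zero]
  unfold Fsl
  rw [hcorr, add_zero]
  simp only [hmain, R6b.sum_sgn, mul_zero]

/-- The upstairs exponent with prescribed slice `b` (on the atoms) and reduced part `ν` (on the free letters). [folklore] -/
def xOf (b : σ × σ → ℕ) (ν : σ → ℕ) : σ ⊕ σ × σ →₀ ℕ :=
  ofFun fun t => match t with
    | Sum.inl k => if Itr.pf k = 0 ∧ Itr.qf k = 0 then ν k else 0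
    | Sum.inr ij => if Itr.pf ij.1 ≠ 0 ∧ Itr.qf ij.2 ≠ 0 then b ij else 0

/-- `xOf` at a free coordinate. [folklore] -/
theorem xOf_inl (b : σ × σ → ℕ) (ν : σ → ℕ) (k : σ) :
    xOf Itr b ν (Sum.inl k) = if Itr.pf k = 0 ∧ Itr.qf k = 0 then ν k else 0 := by
  unfold xOf; rw [ofFun_apply]

/-- `xOf` at an atom coordinate. [folklore] -/
theorem xOf_inr (b : σ × σ → ℕ) (ν : σ → ℕ) (i j : σ) :
    xOf Itr b ν (Sum.inr (i, j)) = if Itr.pf i ≠ 0 ∧ Itr.qf j ≠ 0 then b (i, j) else 0 := by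
  unfold xOf; rw [ofFun_apply]

/-- `xOf` is idle-free. [folklore] -/
theorem idle_xOf (b : σ × σ → ℕ) (ν : σ → ℕ) : Idle Itr (xOf Itr b ν) :=
  ⟨fun k hk => by rw [xOf_inl, if_neg hk], fun i j hij => by rw [xOf_inr, if_neg hij]⟩

/-- `xOf` at an atom. [folklore] -/
theorem xOf_atom (b : σ × σ → ℕ) (ν : σ → ℕ) {i j : σ} (hi : i ∈ P Itr) (hj : j ∈ N Itr) :
    xOf Itr b ν (Sum.inr (i, j)) = b (i, j) := by
  rw [xOf_inr, if_pos ⟨(mem_P Itr i).1 hi, (mem_N Itr j).1 hj⟩]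

/-- The reduced part of `xOf b ν` is `ν`. [folklore] -/
theorem xhat_xOf (b : σ × σ → ℕ) (ν : σ → ℕ) (hν : ∀ k ∈ rel Itr, ν k = 0) : ⇑(xhat Itr (xOf Itr b ν)) = ν := by
  funext k
  by_cases hk : Itr.pf k = 0 ∧ Itr.qf k = 0
  · rw [xhat_rest Itr _ ((mem_rest Itr k).2 hk), xOf_inl, if_pos hk]
  · rw [xhat_rel Itr _ ((mem_rel Itr k).2 hk), hν k ((mem_rel Itr k).2 hk)]

/-- An idle-free exponent is recovered from its slice and its reduced part. [folklore] -/
theorem xOf_xhat (x : σ ⊕ σ × σ →₀ ℕ) (hx : Idle Itr x) : xOf Itr (fun ij => x (Sum.inr ij)) ⇑(xhat Itr x) = x := by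
  ext t
  rcases t with k | ⟨i, j⟩
  · rw [xOf_inl]
    by_cases hk : Itr.pf k = 0 ∧ Itr.qf k = 0
    · rw [if_pos hk, xhat_rest Itr x ((mem_rest Itr k).2 hk)]
    · rw [if_neg hk, hx.1 k hk]
  · rw [xOf_inr]
    by_cases hij : Itr.pf i ≠ 0 ∧ Itr.qf j ≠ 0
    · rw [if_pos hij]
    · rw [if_neg hij, hx.2 i j hij]

/-- `Lrel` reads the slice only on the atoms. [folklore] -/
theorem Lrel_congr {b b' : σ × σ → ℕ} (h : ∀ i ∈ P Itr, ∀ j ∈ N Itr, b (i, j) = b' (i, j)) (κ : ℕ) (k : σ) :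
    Lrel Itr b κ k = Lrel Itr b' κ k := by
  by_cases hka : k = Itr.a₀
  · rw [hka, Lrel_a₀, Lrel_a₀]
  by_cases hkN : k ∈ N Itr
  · rw [Lrel_N Itr b κ hkN, Lrel_N Itr b' κ hkN, h Itr.a₀ (a₀_mem_P Itr) k hkN]
  by_cases hkP : k ∈ P Itr
  · rw [Lrel_P Itr b κ hkP hka, Lrel_P Itr b' κ hkP hka, Lrel_N Itr b κ (b₀_mem_N Itr), Lrel_N Itr b' κ (b₀_mem_N Itr),
      h k hkP Itr.b₀ (b₀_mem_N Itr), h Itr.a₀ (a₀_mem_P Itr) Itr.b₀ (b₀_mem_N Itr)]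
  · have hkr : k ∈ rest Itr := by
      rw [mem_rest]; rw [mem_P] at hkP; rw [mem_N] at hkN; push Not at hkP hkN; exact ⟨hkP, hkN⟩
    rw [Lrel_rest Itr b κ hkr, Lrel_rest Itr b' κ hkr]

/-- The slice data agree on the atoms ⇒ the slice functions agree. [folklore] -/
theorem Fsl_congr (c d : Fin m → σ → ℂ) {b b' : σ × σ → ℕ} (h : ∀ i ∈ P Itr, ∀ j ∈ N Itr, b (i, j) = b' (i, j)) :
    Fsl Itr c d b = Fsl Itr c d b' := by
  have hs : sA Itr b = sA Itr b' := Finset.sum_congr rfl fun i hi => Finset.sum_congr rfl fun j hj => h i hi j hj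
  have hL : ∀ κ k, Lrel Itr b κ k = Lrel Itr b' κ k := fun κ k => Lrel_congr Itr h κ k
  have hA : ∀ κ, Adm Itr b κ ↔ Adm Itr b' κ := fun κ => by
    unfold Adm
    exact ⟨fun H i hi j hj => by rw [← hL, ← hL, ← h i hi j hj]; exact H i hi j hj,
      fun H i hi j hj => by rw [hL, hL, h i hi j hj]; exact H i hi j hj⟩
  have hBk : ∀ κ, Bk Itr b κ = Bk Itr b' κ := fun κ => Finset.sum_congr rfl fun k _ => hL κ k
  have hkap : ∀ κ, kap Itr b κ = kap Itr b' κ := fun κ => by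
    unfold kap; rw [hBk, Finset.prod_congr rfl fun k _ => by rw [hL κ k]]
  have hpp : ∀ t κ, relProd Itr t b κ = relProd Itr t b' κ := fun t κ =>
    Finset.prod_congr rfl fun k _ => by rw [hL κ k]
  have hgd : ∀ κ, gd Itr b κ = gd Itr b' κ := fun κ => by
    unfold gd; exact if_congr (hA κ) rfl rfl
  have hmc : ∀ j κ, mainConst Itr c d b j κ = mainConst Itr c d b' j κ := fun j κ => by
    unfold mainConst; rw [hgd, hs, hBk, hpp, hkap]
  funext ν
  unfold Fsl mainTerm corr
  rw [hs]
  simp only [hmc, hBk]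

end Slice

end R9
end Summit.ValiantsHypothesis.ValiantsHypothesis.Theorems.NewtonUnitEquations.TwoProducts.PermutationType

end
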